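import Mathlib
import Literature.Analysis.FluidPDE.ClassicalSolution
import Literature.Analysis.FluidPDE.LerayHopf
import Literature.Analysis.FluidPDE.NSWave0
import Literature.Analysis.FluidPDE.TaoLocalisation
import Summits.NavierStokesRegularity.NavierStokesRegularity.Theses.L3TimeExponentPincer
import HarnessLib.Audit
import HarnessLib

/-!
# L3TimeExponentPincer — the jaw has no constant (ROUND-11, seat nsreg-p2)

Support kernel for the crux `L3CascadeJaw` (route `L3TimeExponentPincer`): the QUANTITATIVE
shadows of the crux and the exponent bookkeeping that decides them.

* `lpTime p q T u = ∫₀ᵀ ‖u(t)‖_p^q dt` (the crux's functional at `p = 3`), `energy0 u = ∫|u(0)|²`,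
  `IsFrameSolution` (the crux's frame: classical on `[0,T)`, Leray–Hopf, Schwartz datum).
* `QuantBound p q` — the UNIFORM quantitative bound «`∫₀ᵀ‖u‖_p^q ≤ B(E₀, ν, T)` for every frame
  solution»; `QuantJaw q = QuantBound 3 q` is the uniform form of the crux's `q`-clause.
* `LpPersistence p β a` — a PERSISTENCE FAMILY: at `ν = T = 1`, energy `≤ 1`, for every scale
  `ℓ ∈ (0,1]` a frame solution with the floor `‖u(t)‖_p ≥ c ℓ^{-β}` on the window `(0, c ℓ^a)`.
  (Vortex rings give `β = 3/2 - 3/p`, `a = 2`: the L^p floor of an energy-normalised eddy of size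
  `ℓ`, kept for `≍ ℓ²/ν` = `Re` turnovers; one Euler turnover is `a = 5/2`.)
* `not_quantBound_of_persistence` — **threshold theorem** (kernel): `LpPersistence p β a` with
  `a < q β` refutes `QuantBound p q`. At `p = 3` (`β = 1/2`): lifetime exponent `a` kills every
  `q > 2a`; rings (`a = 2`) kill every `q > 4` = everything above the energy line; one turnover
  (`a = 5/2`) kills `q > 5`. In the memo's dictionary `a = (5 - σ)/2` ↔ `q > 5 - σ`.
* `QuantJawData q` — the DATA-CRITICAL quantitative jaw «bounded on every slice
  `{E₀ ≤ E, ‖u₀‖₃ ≤ A}`», the surviving quantitative rung; `l3CascadeJaw_of_quantJawData` (kernel):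
  it implies the crux outright; `quantJawData_modulus_lower` (kernel): a persistence family whose
  data have `‖u₀‖₃ ≤ C₀ ℓ^{-β}` forces every admissible slice bound to be `≥ c^{q+1} ℓ^{a-qβ}`,
  i.e. the modulus grows at least like `A^{(qβ-a)/β}` (`= A^{q-4}` for rings).

No statement here is specific to blow-up; the analytic input (that rings persist) is NOT proved
here — it is the memo's Persistence Lemma, typed as the hypothesis `LpPersistence 3 (1/2) 2`.
-/

namespace Summit.NavierStokesRegularity.NavierStokesRegularity.Theorems.L3TimeExponentPincerQuantJaw

open MeasureTheory Set Literature.Analysis.FluidPDE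
open scoped ENNReal NNReal

/-- `ℝ³`. -/
abbrev E3 := EuclideanSpace ℝ (Fin 3)

/-- The crux's frame: classical solution on `[0,T)`, Leray–Hopf from `u 0`, Schwartz datum
(exactly the three hypotheses of `L3CascadeJaw`). -/
structure IsFrameSolution (ν T : ℝ) (u : ℝ → E3 → E3) (pr : ℝ → E3 → ℝ) : Prop where
  classical : IsClassicalNSSolutionOn (Ico 0 T) ν 0 u pr
  lerayHopf : IsLerayHopfOn T ν 0 (u 0) u
  decay : HasRapidSpatialDecay (u 0)

/-- The mixed-norm time functional `∫₀ᵀ ‖u(t)‖_{L^p}^q dt` (the crux's functional at `p = 3`). -/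
noncomputable def lpTime (p : ℝ≥0∞) (q T : ℝ) (u : ℝ → E3 → E3) : ℝ≥0∞ :=
  ∫⁻ t in Ioo 0 T, eLpNorm (u t) p volume ^ q

/-- Twice the initial energy, `∫ |u(0,x)|² dx`. -/
noncomputable def energy0 (u : ℝ → E3 → E3) : ℝ≥0∞ := ∫⁻ x, ‖u 0 x‖ₑ ^ 2

/-- **QB(p,q): the uniform quantitative bound.** For every viscosity, horizon and energy level
there is ONE constant bounding `∫₀ᵀ‖u‖_p^q` for all frame solutions of that energy. -/
@[conjecture] def QuantBound (p : ℝ≥0∞) (q : ℝ) : Prop :=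
  ∀ ν T E : ℝ, 0 < ν → 0 < T → 0 ≤ E →
    ∃ B : ℝ≥0, ∀ (u : ℝ → E3 → E3) (pr : ℝ → E3 → ℝ), IsFrameSolution ν T u pr →
      energy0 u ≤ ENNReal.ofReal E → lpTime p q T u ≤ B

/-- **QJ(q): the uniform quantitative jaw** — `QuantBound` in the crux's currency `L^q_t L³_x`. -/
@[conjecture] def QuantJaw (q : ℝ) : Prop := QuantBound 3 q

/-- **Persistence family** with floor exponent `β` and lifetime exponent `a` (normalised
`ν = T = 1`, energy `≤ 1`): for every scale `ℓ ∈ (0,1]` a frame solution whose `L^p` norm stays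
above `c ℓ^{-β}` throughout the window `(0, c ℓ^a)`. -/
@[conjecture] def LpPersistence (p : ℝ≥0∞) (β a : ℝ) : Prop :=
  ∃ c : ℝ, 0 < c ∧ c ≤ 1 ∧ ∀ ℓ : ℝ, 0 < ℓ → ℓ ≤ 1 →
    ∃ (u : ℝ → E3 → E3) (pr : ℝ → E3 → ℝ), IsFrameSolution 1 1 u pr ∧ energy0 u ≤ 1 ∧
      ∀ t ∈ Ioo 0 (c * ℓ ^ a), ENNReal.ofReal (c * ℓ ^ (-β)) ≤ eLpNorm (u t) p volume

/-! ### The exponent bookkeeping -/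

/-- Real algebra: `(c ℓ^{-β})^q · (c ℓ^a) = c^{q+1} ℓ^{-(qβ - a)}`. -/
theorem floor_window_product {c ℓ β a q : ℝ} (hc : 0 < c) (hℓ : 0 < ℓ) :
    (c * ℓ ^ (-β)) ^ q * (c * ℓ ^ a) = c ^ (q + 1) * ℓ ^ (-(q * β - a)) := by
  rw [Real.mul_rpow hc.le (Real.rpow_nonneg hℓ.le _), ← Real.rpow_mul hℓ.le,
    Real.rpow_add hc, Real.rpow_one, show -(q * β - a) = -β * q + a by ring, Real.rpow_add hℓ]
  ring

/-- **Lower bound from a floor.** If `‖u(t)‖_p ≥ c ℓ^{-β}` on `(0, cℓ^a) ⊆ (0,1)` then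
`∫₀¹ ‖u‖_p^q ≥ c^{q+1} ℓ^{-(qβ-a)}` (`q ≥ 0`). -/
theorem lpTime_lower_of_floor {p : ℝ≥0∞} {q c ℓ β a : ℝ} (hq : 0 ≤ q) (hc : 0 < c) (hℓ : 0 < ℓ)
    (hwin : c * ℓ ^ a ≤ 1) {u : ℝ → E3 → E3}
    (hfloor : ∀ t ∈ Ioo 0 (c * ℓ ^ a), ENNReal.ofReal (c * ℓ ^ (-β)) ≤ eLpNorm (u t) p volume) :
    ENNReal.ofReal (c ^ (q + 1) * ℓ ^ (-(q * β - a))) ≤ lpTime p q 1 u := by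
  have hx : 0 ≤ c * ℓ ^ (-β) := mul_nonneg hc.le (Real.rpow_nonneg hℓ.le _)
  have hw : 0 ≤ c * ℓ ^ a := mul_nonneg hc.le (Real.rpow_nonneg hℓ.le _)
  calc ENNReal.ofReal (c ^ (q + 1) * ℓ ^ (-(q * β - a)))
      = ENNReal.ofReal ((c * ℓ ^ (-β)) ^ q * (c * ℓ ^ a)) := by rw [floor_window_product hc hℓ]
    _ = ENNReal.ofReal (c * ℓ ^ (-β)) ^ q * volume (Ioo 0 (c * ℓ ^ a)) := by
        rw [ENNReal.ofReal_mul (Real.rpow_nonneg hx _), ENNReal.ofReal_rpow_of_nonneg hx hq,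
          Real.volume_Ioo, sub_zero]
    _ = ∫⁻ _ in Ioo 0 (c * ℓ ^ a), ENNReal.ofReal (c * ℓ ^ (-β)) ^ q := (setLIntegral_const _ _).symm
    _ ≤ ∫⁻ t in Ioo 0 (c * ℓ ^ a), eLpNorm (u t) p volume ^ q :=
        setLIntegral_mono' measurableSet_Ioo fun t ht => ENNReal.rpow_le_rpow (hfloor t ht) hq
    _ ≤ lpTime p q 1 u := lintegral_mono_set (Ioo_subset_Ioo le_rfl hwin)

/-- **Threshold theorem: persistence beats every uniform bound above its line.** A persistence
family with floor exponent `β > 0` and lifetime exponent `a ≥ 0` refutes `QuantBound p q` for every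
`q` with `q β > a`. (Rings: `p = 3`, `β = 1/2`, `a = 2` ⇒ all `q > 4`.) -/
theorem not_quantBound_of_persistence {p : ℝ≥0∞} {β a q : ℝ} (ha : 0 ≤ a) (hq : 0 ≤ q)
    (hP : LpPersistence p β a) (hqa : a < q * β) : ¬ QuantBound p q := by
  intro hQ
  obtain ⟨c, hc, hc1, hfam⟩ := hP
  obtain ⟨B, hB⟩ := hQ 1 1 1 one_pos one_pos zero_le_one
  -- the scale at which the persistence family beats `B`
  set s : ℝ := q * β - a with hs_def
  have hs : 0 < s := by rw [hs_def]; linarith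
  have hcq : 0 < c ^ (q + 1) := Real.rpow_pos_of_pos hc _
  set M : ℝ := ((B : ℝ) + 1) / c ^ (q + 1) with hM_def
  have hM : 0 < M := div_pos (by positivity) hcq
  set Y : ℝ := M ^ (-s)⁻¹ with hY_def
  have hY : 0 < Y := Real.rpow_pos_of_pos hM _
  set ℓ : ℝ := min 1 Y with hℓ_def
  have hℓ : 0 < ℓ := lt_min one_pos hY
  have hℓ1 : ℓ ≤ 1 := min_le_left _ _
  have hℓY : ℓ ≤ Y := min_le_right _ _
  -- the window fits inside `(0, 1)`
  have hwin : c * ℓ ^ a ≤ 1 := by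
    calc c * ℓ ^ a ≤ 1 * 1 :=
          mul_le_mul hc1 (Real.rpow_le_one hℓ.le hℓ1 ha) (Real.rpow_nonneg hℓ.le _) zero_le_one
      _ = 1 := one_mul _
  obtain ⟨u, pr, hframe, hE, hfloor⟩ := hfam ℓ hℓ hℓ1
  have hup : lpTime p q 1 u ≤ B := hB u pr hframe (by rwa [ENNReal.ofReal_one])
  have hlow := lpTime_lower_of_floor hq hc hℓ hwin hfloor
  -- `c^{q+1} ℓ^{-s} ≥ B + 1`
  have hkey : (B : ℝ) + 1 ≤ c ^ (q + 1) * ℓ ^ (-(q * β - a)) := by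
    rw [← hs_def]
    have h1 : M ≤ ℓ ^ (-s) := by
      calc M = Y ^ (-s) := by rw [hY_def, Real.rpow_inv_rpow hM.le (by linarith)]
        _ ≤ ℓ ^ (-s) := Real.rpow_le_rpow_of_nonpos hℓ hℓY (by linarith)
    calc (B : ℝ) + 1 = c ^ (q + 1) * M := by rw [hM_def]; field_simp
      _ ≤ c ^ (q + 1) * ℓ ^ (-s) := mul_le_mul_of_nonneg_left h1 hcq.le
  have hlt : (B : ℝ≥0∞) < ENNReal.ofReal ((B : ℝ) + 1) := by
    rw [← ENNReal.ofReal_coe_nnreal]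
    exact (ENNReal.ofReal_lt_ofReal_iff (by positivity)).2 (by linarith)
  exact absurd (hlt.trans_le ((ENNReal.ofReal_le_ofReal hkey).trans (hlow.trans hup)))
    (lt_irrefl _)

/-- **The jaw has no constant.** Ring persistence (`L³` floor `c ℓ^{-1/2}` for `≍ ℓ²` = `Re`
turnovers) refutes the uniform quantitative jaw for EVERY `q > 4`: above the energy line no
`(E₀, ν, T)`-uniform bound on `∫‖u‖₃^q` exists. -/
theorem not_quantJaw_of_ringPersistence (hP : LpPersistence 3 (1 / 2) 2) {q : ℝ} (hq : 4 < q) :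
    ¬ QuantJaw q :=
  not_quantBound_of_persistence (by norm_num) (by linarith) hP (by linarith)

/-- **One Euler turnover kills `q > 5`.** Persistence for a single turnover time `≍ ℓ/U`
(`a = 5/2` in energy units) refutes the uniform jaw for every `q > 5`; the window `4 < q ≤ 5` is
invisible to single-turnover dynamics. -/
theorem not_quantJaw_of_oneTurnover (hP : LpPersistence 3 (1 / 2) (5 / 2)) {q : ℝ} (hq : 5 < q) :
    ¬ QuantJaw q :=
  not_quantBound_of_persistence (by norm_num) (by linarith) hP (by linarith)

/-- **The persistence dictionary `q > 5 - σ`.** Idling for `Re^σ` turnovers is lifetime exponent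
`a = (5 - σ)/2`; it refutes the uniform jaw for every `q > 5 - σ` (`σ ∈ [0,1]`; `σ = 1` is the
viscous cap, attained by rings). -/
theorem not_quantJaw_of_sigmaPersistence {σ : ℝ} (hσ : σ ≤ 5)
    (hP : LpPersistence 3 (1 / 2) ((5 - σ) / 2)) {q : ℝ} (hq : 5 - σ < q) : ¬ QuantJaw q :=
  not_quantBound_of_persistence (by linarith) (by linarith) hP (by linarith)

/-- **The energy line is rigid in every mixed norm.** An `L^p` ring floor `c ℓ^{-(3/2 - 3/p')}`
(`p'` the real exponent) kept for `≍ ℓ²` turnovers refutes `QuantBound p q` for every `q` with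
`2/q + 3/p' < 3/2` — the whole strip between the energy line and the Serrin line, where scaling
alone says nothing. -/
theorem not_quantBound_above_energyLine {p : ℝ≥0∞} {p' q : ℝ} (hq : 0 < q)
    (hP : LpPersistence p (3 / 2 - 3 / p') 2) (hline : 2 / q + 3 / p' < 3 / 2) :
    ¬ QuantBound p q := by
  refine not_quantBound_of_persistence (by norm_num) hq.le hP ?_
  have h1 : 2 / q < 3 / 2 - 3 / p' := by linarith
  have h2 : 2 < q * (3 / 2 - 3 / p') := by
    have := (div_lt_iff₀ hq).1 h1
    linarith
  linarith

/-! ### The data-critical quantitative jaw -/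

/-- **QJ_data(q): the data-critical quantitative jaw.** On every data slice
`{E₀ ≤ E, ‖u₀‖_{L³} ≤ A}` (fixed `ν`, `T`) the functional `∫₀ᵀ‖u‖₃^q` is bounded. This is the
weakest quantitative form of the crux that survives the rings; it is implied by a critical
a-priori bound `sup_t ‖u(t)‖₃ ≤ F(‖u₀‖₃, E₀, ν)` and implies `L3CascadeJaw`. -/
@[conjecture] def QuantJawData (q : ℝ) : Prop :=
  ∀ ν T E A : ℝ, 0 < ν → 0 < T → 0 ≤ E → 0 ≤ A →
    ∃ B : ℝ≥0, ∀ (u : ℝ → E3 → E3) (pr : ℝ → E3 → ℝ), IsFrameSolution ν T u pr →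
      energy0 u ≤ ENNReal.ofReal E → eLpNorm (u 0) 3 volume ≤ ENNReal.ofReal A →
        lpTime 3 q T u ≤ B

/-- A Schwartz datum has finite energy. -/
theorem energy0_lt_top_of_hasRapidSpatialDecay {u : ℝ → E3 → E3}
    (h : HasRapidSpatialDecay (u 0)) : energy0 u < ⊤ := by
  have h0 := h.lintegral_enorm_iteratedFDeriv_sq_lt_top (μ := volume) 0
  have e : (fun x => ‖iteratedFDeriv ℝ 0 (u 0) x‖ₑ ^ 2) = fun x => ‖u 0 x‖ₑ ^ 2 := by
    funext x
    rw [← ofReal_norm, norm_iteratedFDeriv_zero, ofReal_norm]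
  unfold energy0
  rwa [e] at h0

/-- A Schwartz datum has finite `L³` norm (bounded times finite energy). -/
theorem eLpNorm_three_lt_top_of_hasRapidSpatialDecay {u : ℝ → E3 → E3}
    (h : HasRapidSpatialDecay (u 0)) : eLpNorm (u 0) 3 volume < ⊤ := by
  obtain ⟨C, hC⟩ := h 0 0
  have hCpt : ∀ x, ‖u 0 x‖ ≤ C := fun x => by simpa [norm_iteratedFDeriv_zero] using hC x
  have hE := energy0_lt_top_of_hasRapidSpatialDecay h
  have h3 : ∫⁻ x, ‖u 0 x‖ₑ ^ (3 : ℝ) ≤ (∫⁻ x, ‖u 0 x‖ₑ ^ 2) * ENNReal.ofReal C := by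
    rw [← lintegral_mul_const' _ _ ENNReal.ofReal_ne_top]
    refine lintegral_mono fun x => ?_
    have e : ‖u 0 x‖ₑ ^ (3 : ℝ) = ‖u 0 x‖ₑ ^ 2 * ‖u 0 x‖ₑ := by
      rw [show (3 : ℝ) = ((3 : ℕ) : ℝ) by norm_num, ENNReal.rpow_natCast, pow_succ]
    rw [e]
    gcongr
    rw [← ofReal_norm]
    exact ENNReal.ofReal_le_ofReal (hCpt x)
  have hfin : ∫⁻ x, ‖u 0 x‖ₑ ^ (3 : ℝ) < ⊤ :=
    h3.trans_lt (ENNReal.mul_lt_top hE ENNReal.ofReal_lt_top)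
  rw [eLpNorm_eq_lintegral_rpow_enorm_toReal (by norm_num) (by norm_num)]
  simp only [ENNReal.toReal_ofNat]
  exact ENNReal.rpow_lt_top_of_nonneg (by norm_num) hfin.ne

/-- **QJ_data(q) ⇒ the `q`-clause of the crux.** A data-critical bound gives
`∫_{T/2}^{T} ‖u‖₃^q < ∞` for every frame solution (Schwartz data have finite energy and `L³` norm). -/
theorem jaw_clause_of_quantJawData {q : ℝ} (hQ : QuantJawData q) {ν T : ℝ} (hν : 0 < ν)
    (hT : 0 < T) {u : ℝ → E3 → E3} {pr : ℝ → E3 → ℝ}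
    (hcl : IsClassicalNSSolutionOn (Ico 0 T) ν 0 u pr) (hLH : IsLerayHopfOn T ν 0 (u 0) u)
    (hdec : HasRapidSpatialDecay (u 0)) :
    ∃ T₂ ∈ Ioo 0 T, (∫⁻ t in Ioo T₂ T, eLpNorm (u t) 3 volume ^ q) < ⊤ := by
  have hE := energy0_lt_top_of_hasRapidSpatialDecay hdec
  have hA := eLpNorm_three_lt_top_of_hasRapidSpatialDecay hdec
  obtain ⟨B, hB⟩ := hQ ν T (energy0 u).toReal (eLpNorm (u 0) 3 volume).toReal hν hT
    ENNReal.toReal_nonneg ENNReal.toReal_nonneg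
  have hb := hB u pr ⟨hcl, hLH, hdec⟩ (by rw [ENNReal.ofReal_toReal hE.ne])
    (by rw [ENNReal.ofReal_toReal hA.ne])
  refine ⟨T / 2, ⟨by linarith, by linarith⟩, ?_⟩
  calc (∫⁻ t in Ioo (T / 2) T, eLpNorm (u t) 3 volume ^ q)
      ≤ lpTime 3 q T u := lintegral_mono_set (Ioo_subset_Ioo (by linarith) le_rfl)
    _ ≤ B := hb
    _ < ⊤ := ENNReal.coe_lt_top

/-- **The data-critical quantitative jaw implies the crux.** -/
theorem l3CascadeJaw_of_quantJawData (hQ : ∀ q : ℝ, 4 < q → q < 5 → QuantJawData q) :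
    Theses.L3TimeExponentPincer.L3CascadeJaw := by
  intro q hq4 hq5 ν T hν hT u pr hcl hLH hdec
  exact jaw_clause_of_quantJawData (hQ q hq4 hq5) hν hT hcl hLH hdec

/-- **Persistence family with controlled data.** As `LpPersistence 3 β a`, and the data have
`‖u₀‖₃ ≤ C₀ ℓ^{-β}` (rings: the datum IS an eddy of size `ℓ`, so `C₀` is a shape constant). -/
@[conjecture] def L3PersistenceWithData (β a : ℝ) : Prop :=
  ∃ c C₀ : ℝ, 0 < c ∧ c ≤ 1 ∧ 0 < C₀ ∧ ∀ ℓ : ℝ, 0 < ℓ → ℓ ≤ 1 →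
    ∃ (u : ℝ → E3 → E3) (pr : ℝ → E3 → ℝ), IsFrameSolution 1 1 u pr ∧ energy0 u ≤ 1 ∧
      eLpNorm (u 0) 3 volume ≤ ENNReal.ofReal (C₀ * ℓ ^ (-β)) ∧
      ∀ t ∈ Ioo 0 (c * ℓ ^ a), ENNReal.ofReal (c * ℓ ^ (-β)) ≤ eLpNorm (u t) 3 volume

/-- **Modulus lower bound (rings calibrate every data-critical jaw).** If a persistence family
with controlled data exists, then every bound `B` admissible for `QuantJawData q` on the slice
`ν = T = 1`, `E₀ ≤ 1`, `‖u₀‖₃ ≤ C₀ ℓ^{-β}` satisfies `B ≥ c^{q+1} ℓ^{-(qβ - a)}`: with `A = C₀ℓ^{-β}`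
the modulus grows at least like `A^{(qβ-a)/β}` — for rings (`β = 1/2`, `a = 2`) like `A^{q-4}`,
the power saturated in the Kato regime. -/
theorem quantJawData_modulus_lower {β a q : ℝ} (ha : 0 ≤ a) (hq : 0 ≤ q)
    (hP : L3PersistenceWithData β a) :
    ∃ c C₀ : ℝ, 0 < c ∧ 0 < C₀ ∧ ∀ ℓ : ℝ, 0 < ℓ → ℓ ≤ 1 → ∀ B : ℝ≥0,
      (∀ (u : ℝ → E3 → E3) (pr : ℝ → E3 → ℝ), IsFrameSolution 1 1 u pr → energy0 u ≤ 1 →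
        eLpNorm (u 0) 3 volume ≤ ENNReal.ofReal (C₀ * ℓ ^ (-β)) → lpTime 3 q 1 u ≤ B) →
      ENNReal.ofReal (c ^ (q + 1) * ℓ ^ (-(q * β - a))) ≤ B := by
  obtain ⟨c, C₀, hc, hc1, hC₀, hfam⟩ := hP
  refine ⟨c, C₀, hc, hC₀, fun ℓ hℓ hℓ1 B hB => ?_⟩
  obtain ⟨u, pr, hframe, hE, hdat, hfloor⟩ := hfam ℓ hℓ hℓ1
  have hwin : c * ℓ ^ a ≤ 1 := by
    calc c * ℓ ^ a ≤ 1 * 1 :=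
          mul_le_mul hc1 (Real.rpow_le_one hℓ.le hℓ1 ha) (Real.rpow_nonneg hℓ.le _) zero_le_one
      _ = 1 := one_mul _
  exact (lpTime_lower_of_floor hq hc hℓ hwin hfloor).trans (hB u pr hframe hE hdat)

/--
info: 'Summit.NavierStokesRegularity.NavierStokesRegularity.Theorems.L3TimeExponentPincerQuantJaw.not_quantBound_of_persistence' depends on axioms: [propext,
 Classical.choice,
 Quot.sound]
-/
#guard_msgs in
#print axioms not_quantBound_of_persistence

/--
info: 'Summit.NavierStokesRegularity.NavierStokesRegularity.Theorems.L3TimeExponentPincerQuantJaw.l3CascadeJaw_of_quantJawData' depends on axioms: [propext,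
 Classical.choice,
 Quot.sound]
-/
#guard_msgs in
#print axioms l3CascadeJaw_of_quantJawData

/--
info: 'Summit.NavierStokesRegularity.NavierStokesRegularity.Theorems.L3TimeExponentPincerQuantJaw.quantJawData_modulus_lower' depends on axioms: [propext,
 Classical.choice,
 Quot.sound]
-/
#guard_msgs in
#print axioms quantJawData_modulus_lower

end Summit.NavierStokesRegularity.NavierStokesRegularity.Theorems.L3TimeExponentPincerQuantJaw
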